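import Summits.BirchSwinnertonDyer.BirchSwinnertonDyer.Theorems.KolyvaginDepthDoorDepthTableRowKitNoTwistTwistSelmer
import Summits.BirchSwinnertonDyer.BirchSwinnertonDyer.Theorems.KolyvaginDepthDoorDepthTableRowsOfPrint5
import Summits.BirchSwinnertonDyer.BirchSwinnertonDyer.Theorems.KolyvaginDepthDoorDepthTableRowsOfPrint6
import HarnessLib

/-!
# Route `KolyvaginDepthDoor` — DEPTH-TABLE rows `997c1` `(5, -67, 229)`, `664a1` `(5, -39, 29)`, `916c1` `(5, -111, 19)`, `944e1` `(5, -31, 239)`: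
# the TWIST'S `p`-Selmer group, without Kolyvagin's structure theorem and without a point on the
# twist (crux `KolyvaginDepthSupply`, stmt-BirchSwinnertonDyer-21765) — part 4 of 4

Helper file (`--supports stmt-BirchSwinnertonDyer-21765 --as helper`); it closes nothing and BSD is
not proved by it.

Companions of the rows `C<label>.depthRow_<p>_neg<D>_<ℓ>_noTwist` (files `…DepthTableRowsNoTwist*`), SAME
hypotheses (five named McCallum/Gross leaves, compatible Kolyvagin–Heegner system, the bit; no twist
point, no `hF`), read on the OTHER eigenspace: Kolyvagin's `#Sel(E/K)_p^- ≤ p` becomes, through the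
injection `Sel_p(E^{(D)}/ℚ) ↪ Sel_p(E/K)^-` (Literature `SelmerTorsionTwistRestriction`, PROVED),
`#Sel^(p)(E^{(D)}/ℚ) ≤ p` and `p^{rank E^{(D)}} · #E^{(D)}(ℚ)[p] · #Ш(E^{(D)}/ℚ)[p] ≤ p` — so
`rank E^{(D)}(ℚ) ≤ 1`, and `rank E^{(D)}(ℚ) = 1` would force `E^{(D)}(ℚ)[p] = Ш(E^{(D)}/ℚ)[p] = 0`. Kit:
`depthRow_noTwist_twistSelmer_of_print_of_intModel_certificate` (file `…DepthTableRowKitNoTwistTwistSelmer`).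
Per-curve side conditions are the kernel theorems already in the tree. Per-curve; BSD is not proved by it.
-/

set_option linter.dupNamespace false

noncomputable section

open scoped Classical NumberField

namespace Summit.BirchSwinnertonDyer.BirchSwinnertonDyer.Theorems.KolyvaginDepthDoor

open Literature.NumberTheory.EllipticCurves Literature.NumberTheory.EllipticCurves.ModularForms
  Literature.NumberTheory.EllipticCurves.McCallum1991 WeierstrassCurve
open Summit.BirchSwinnertonDyer.BirchSwinnertonDyer.Rank2Observatory
open Summit.BirchSwinnertonDyer.BirchSwinnertonDyer.Rank1Residual

namespace C997c1

/-- **DEPTH-TABLE ROW `997c1`, `(p, d_K, ℓ) = (5, -67, 229)` — THE TWIST'S `5`-SELMER GROUP, without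
Kolyvagin's structure theorem and without a point on the twist.** Hypotheses VERBATIM those of
`C997c1.depthRow_5_neg67_229_noTwist` (five named McCallum/Gross leaves, any imaginary quadratic `K` with `d_K = -67`,
any frame and COMPATIBLE system of Kolyvagin–Heegner data, the bit `(d 229).kolyvaginClass _ 1 ≠ 0`);
conclusion: `#Sel^(5)(E^{(-67)}/ℚ) ≤ 5` (i.e. `dim_𝔽5 Sel_5(E^{(-67)}/ℚ) ≤ 1`) and the descent count
`5^{rank E^{(-67)}(ℚ)} · #E^{(-67)}(ℚ)[5] · #Ш(E^{(-67)}/ℚ)[5] ≤ 5` — Kolyvagin's second eigen-bound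
`#Sel(E/K)_5^- ≤ 5` read over `ℚ` (kit `depthRow_noTwist_twistSelmer_of_print_of_intModel_certificate`); the
hF-free, twist-point-free counterpart of the hF-row's `corank Sel_{5^∞}(E^{(-67)}/ℚ) = 1`. CONDITIONAL on the
five facts and the bit; per-curve; BSD is not proved by it. [cite: Kolyvagin1991MathAnn, Thm. 2.3]
[cite: McCallumLMS1991, §§2–5] [cite: GrossLMS1991, §5 (5.1)]
[cite: JetchevLauterStein2009, §3.6 (arXiv:0707.0032)] -/
theorem twistSelmer_5_neg67_229_noTwist
    (h54 : sign_conjAct_kolyvaginClass) (h43 : lemma43_kolyvaginClass_mem_selmerLocalKer)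
    (h44 : prop44_localOrder_kolyvaginClass_mul_eq) (h53 : lemma53_selmer_eigen_dependent_at)
    (h22 : prop22_reciprocity_eigen_finset)
    (K : Type) [Field K] [NumberField K] (hK : IsImaginaryQuadratic K)
    (hD : NumberField.discr K = -67) :
    haveI := isElliptic_c997c1;
    haveI := isGloballyMinimal_c997c1;
    haveI : NeZero (((⟨0, -1, 1, -24, 54⟩ : WeierstrassCurve ℤ).map (Int.castRingHom ℚ)).conductorNorm ℤ) :=
      neZero_conductorNorm_of_isElliptic _;
    ∀ (Dt : ModularParametrizationData ((⟨0, -1, 1, -24, 54⟩ : WeierstrassCurve ℤ).map (Int.castRingHom ℚ))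
        (((⟨0, -1, 1, -24, 54⟩ : WeierstrassCurve ℤ).map (Int.castRingHom ℚ)).conductorNorm ℤ)) (β : ℤ)
      (ι : K →+* ℂ) (d : ∀ m : ℕ, KolyvaginHeegnerData Dt β ι m),
    (∀ (m l : ℕ), ∀ l' ∈ m.primeFactors, ∀ (x : ringClassField K ι m)
      (x' : ringClassField K ι (m * l)),
      (x : ℂ) = x' → (((d (m * l)).σ l' x' : ringClassField K ι (m * l)) : ℂ) = ((d m).σ l' x : ℂ)) →
    (∀ (m l : ℕ), ∀ s ∈ (d m).S, ∃ s' ∈ (d (m * l)).S, ∀ (x : ringClassField K ι m)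
      (x' : ringClassField K ι (m * l)),
      (x : ℂ) = x' → ((s' x' : ringClassField K ι (m * l)) : ℂ) = (s x : ℂ)) →
    (∀ (m l : ℕ), ∀ s' ∈ (d (m * l)).S, ∃ s ∈ (d m).S, ∀ (x : ringClassField K ι m)
      (x' : ringClassField K ι (m * l)),
      (x : ℂ) = x' → ((s' x' : ringClassField K ι (m * l)) : ℂ) = (s x : ℂ)) →
    (∀ (m l : ℕ) (x : ringClassField K ι m) (x' : ringClassField K ι (m * l)),
      (x : ℂ) = x' → (d (m * l)).emb x' = (d m).emb x) →
    (d 229).kolyvaginClass (p := 5) (by norm_num) 1 ≠ 0 →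
    Nat.card ↥(selmerGroup (((⟨0, -1, 1, -24, 54⟩ : WeierstrassCurve ℤ).map (Int.castRingHom ℚ)).quadraticTwist
        ((-67 : ℤ) : ℚ)) ((5 : ℕ) : ℤ)) ≤ 5 ∧
      5 ^ (((⟨0, -1, 1, -24, 54⟩ : WeierstrassCurve ℤ).map (Int.castRingHom ℚ)).quadraticTwist
        ((-67 : ℤ) : ℚ)).mordellWeilRank *
          Nat.card ↥(AddSubgroup.torsionBy (((⟨0, -1, 1, -24, 54⟩ : WeierstrassCurve ℤ).map (Int.castRingHom ℚ)).quadraticTwist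
        ((-67 : ℤ) : ℚ)).toAffine.Point ((5 : ℕ) : ℤ)) *
          Nat.card ↥((((⟨0, -1, 1, -24, 54⟩ : WeierstrassCurve ℤ).map (Int.castRingHom ℚ)).quadraticTwist
        ((-67 : ℤ) : ℚ)).sha ⊓
            AddSubgroup.torsionBy (((⟨0, -1, 1, -24, 54⟩ : WeierstrassCurve ℤ).map (Int.castRingHom ℚ)).quadraticTwist
        ((-67 : ℤ) : ℚ)).galH1 ((5 : ℕ) : ℤ)) ≤ 5 := by
  haveI := isElliptic_c997c1
  haveI := isGloballyMinimal_c997c1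
  haveI : NeZero (((⟨0, -1, 1, -24, 54⟩ : WeierstrassCurve ℤ).map (Int.castRingHom ℚ)).conductorNorm ℤ) :=
    neZero_conductorNorm_of_isElliptic _
  intro Dt β ι d hσ hS₁ hS₂ hemb hne
  haveI := Fact.mk (by norm_num : Nat.Prime 5)
  exact depthRow_noTwist_twistSelmer_of_print_of_intModel_certificate intModel h54 h43 h44 h53 h22 not_hasCM
    KernelCerts003.C997c1.two_le_rank 5 (by norm_num) hasSurjectiveModNGaloisRep_pow_5 K hK hD
    (by norm_num) (by norm_num) heegner_neg67 229 (by norm_num) (by norm_num) (by decide +kernel)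
    (by norm_num) (by norm_num) (by norm_num) (by norm_num) (n := 255) card_229 (by norm_num) Dt β ι
    d hσ hS₁ hS₂ hemb hne

end C997c1

namespace C664a1

/-- **DEPTH-TABLE ROW `664a1`, `(p, d_K, ℓ) = (5, -39, 29)` — THE TWIST'S `5`-SELMER GROUP, without
Kolyvagin's structure theorem and without a point on the twist.** Hypotheses VERBATIM those of
`C664a1.depthRow_5_neg39_29_noTwist` (five named McCallum/Gross leaves, any imaginary quadratic `K` with `d_K = -39`,
any frame and COMPATIBLE system of Kolyvagin–Heegner data, the bit `(d 29).kolyvaginClass _ 1 ≠ 0`);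
conclusion: `#Sel^(5)(E^{(-39)}/ℚ) ≤ 5` (i.e. `dim_𝔽5 Sel_5(E^{(-39)}/ℚ) ≤ 1`) and the descent count
`5^{rank E^{(-39)}(ℚ)} · #E^{(-39)}(ℚ)[5] · #Ш(E^{(-39)}/ℚ)[5] ≤ 5` — Kolyvagin's second eigen-bound
`#Sel(E/K)_5^- ≤ 5` read over `ℚ` (kit `depthRow_noTwist_twistSelmer_of_print_of_intModel_certificate`); the
hF-free, twist-point-free counterpart of the hF-row's `corank Sel_{5^∞}(E^{(-39)}/ℚ) = 1`. CONDITIONAL on the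
five facts and the bit; per-curve; BSD is not proved by it. [cite: Kolyvagin1991MathAnn, Thm. 2.3]
[cite: McCallumLMS1991, §§2–5] [cite: GrossLMS1991, §5 (5.1)]
[cite: JetchevLauterStein2009, §3.6 (arXiv:0707.0032)] -/
theorem twistSelmer_5_neg39_29_noTwist
    (h54 : sign_conjAct_kolyvaginClass) (h43 : lemma43_kolyvaginClass_mem_selmerLocalKer)
    (h44 : prop44_localOrder_kolyvaginClass_mul_eq) (h53 : lemma53_selmer_eigen_dependent_at)
    (h22 : prop22_reciprocity_eigen_finset)
    (K : Type) [Field K] [NumberField K] (hK : IsImaginaryQuadratic K)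
    (hD : NumberField.discr K = -39) :
    haveI := isElliptic_c664a1;
    haveI := isGloballyMinimal_c664a1;
    haveI : NeZero (((⟨0, 0, 0, -7, 10⟩ : WeierstrassCurve ℤ).map (Int.castRingHom ℚ)).conductorNorm ℤ) :=
      neZero_conductorNorm_of_isElliptic _;
    ∀ (Dt : ModularParametrizationData ((⟨0, 0, 0, -7, 10⟩ : WeierstrassCurve ℤ).map (Int.castRingHom ℚ))
        (((⟨0, 0, 0, -7, 10⟩ : WeierstrassCurve ℤ).map (Int.castRingHom ℚ)).conductorNorm ℤ)) (β : ℤ)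
      (ι : K →+* ℂ) (d : ∀ m : ℕ, KolyvaginHeegnerData Dt β ι m),
    (∀ (m l : ℕ), ∀ l' ∈ m.primeFactors, ∀ (x : ringClassField K ι m)
      (x' : ringClassField K ι (m * l)),
      (x : ℂ) = x' → (((d (m * l)).σ l' x' : ringClassField K ι (m * l)) : ℂ) = ((d m).σ l' x : ℂ)) →
    (∀ (m l : ℕ), ∀ s ∈ (d m).S, ∃ s' ∈ (d (m * l)).S, ∀ (x : ringClassField K ι m)
      (x' : ringClassField K ι (m * l)),
      (x : ℂ) = x' → ((s' x' : ringClassField K ι (m * l)) : ℂ) = (s x : ℂ)) →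
    (∀ (m l : ℕ), ∀ s' ∈ (d (m * l)).S, ∃ s ∈ (d m).S, ∀ (x : ringClassField K ι m)
      (x' : ringClassField K ι (m * l)),
      (x : ℂ) = x' → ((s' x' : ringClassField K ι (m * l)) : ℂ) = (s x : ℂ)) →
    (∀ (m l : ℕ) (x : ringClassField K ι m) (x' : ringClassField K ι (m * l)),
      (x : ℂ) = x' → (d (m * l)).emb x' = (d m).emb x) →
    (d 29).kolyvaginClass (p := 5) (by norm_num) 1 ≠ 0 →
    Nat.card ↥(selmerGroup (((⟨0, 0, 0, -7, 10⟩ : WeierstrassCurve ℤ).map (Int.castRingHom ℚ)).quadraticTwist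
        ((-39 : ℤ) : ℚ)) ((5 : ℕ) : ℤ)) ≤ 5 ∧
      5 ^ (((⟨0, 0, 0, -7, 10⟩ : WeierstrassCurve ℤ).map (Int.castRingHom ℚ)).quadraticTwist
        ((-39 : ℤ) : ℚ)).mordellWeilRank *
          Nat.card ↥(AddSubgroup.torsionBy (((⟨0, 0, 0, -7, 10⟩ : WeierstrassCurve ℤ).map (Int.castRingHom ℚ)).quadraticTwist
        ((-39 : ℤ) : ℚ)).toAffine.Point ((5 : ℕ) : ℤ)) *
          Nat.card ↥((((⟨0, 0, 0, -7, 10⟩ : WeierstrassCurve ℤ).map (Int.castRingHom ℚ)).quadraticTwist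
        ((-39 : ℤ) : ℚ)).sha ⊓
            AddSubgroup.torsionBy (((⟨0, 0, 0, -7, 10⟩ : WeierstrassCurve ℤ).map (Int.castRingHom ℚ)).quadraticTwist
        ((-39 : ℤ) : ℚ)).galH1 ((5 : ℕ) : ℤ)) ≤ 5 := by
  haveI := isElliptic_c664a1
  haveI := isGloballyMinimal_c664a1
  haveI : NeZero (((⟨0, 0, 0, -7, 10⟩ : WeierstrassCurve ℤ).map (Int.castRingHom ℚ)).conductorNorm ℤ) :=
    neZero_conductorNorm_of_isElliptic _
  intro Dt β ι d hσ hS₁ hS₂ hemb hne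
  haveI := Fact.mk (by norm_num : Nat.Prime 5)
  exact depthRow_noTwist_twistSelmer_of_print_of_intModel_certificate intModel h54 h43 h44 h53 h22 not_hasCM
    KernelCerts001.C664a1.two_le_rank 5 (by norm_num) hasSurjectiveModNGaloisRep_pow_5 K hK hD
    (by norm_num) (by norm_num) heegner_neg39 29 (by norm_num) (by norm_num) (by decide +kernel)
    (by norm_num) (by norm_num) (by norm_num) (by norm_num) (n := 25) card_29 (by norm_num) Dt β ι
    d hσ hS₁ hS₂ hemb hne

end C664a1

namespace C916c1

/-- **DEPTH-TABLE ROW `916c1`, `(p, d_K, ℓ) = (5, -111, 19)` — THE TWIST'S `5`-SELMER GROUP, without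
Kolyvagin's structure theorem and without a point on the twist.** Hypotheses VERBATIM those of
`C916c1.depthRow_5_neg111_19_noTwist` (five named McCallum/Gross leaves, any imaginary quadratic `K` with `d_K = -111`,
any frame and COMPATIBLE system of Kolyvagin–Heegner data, the bit `(d 19).kolyvaginClass _ 1 ≠ 0`);
conclusion: `#Sel^(5)(E^{(-111)}/ℚ) ≤ 5` (i.e. `dim_𝔽5 Sel_5(E^{(-111)}/ℚ) ≤ 1`) and the descent count
`5^{rank E^{(-111)}(ℚ)} · #E^{(-111)}(ℚ)[5] · #Ш(E^{(-111)}/ℚ)[5] ≤ 5` — Kolyvagin's second eigen-bound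
`#Sel(E/K)_5^- ≤ 5` read over `ℚ` (kit `depthRow_noTwist_twistSelmer_of_print_of_intModel_certificate`); the
hF-free, twist-point-free counterpart of the hF-row's `corank Sel_{5^∞}(E^{(-111)}/ℚ) = 1`. CONDITIONAL on the
five facts and the bit; per-curve; BSD is not proved by it. [cite: Kolyvagin1991MathAnn, Thm. 2.3]
[cite: McCallumLMS1991, §§2–5] [cite: GrossLMS1991, §5 (5.1)]
[cite: JetchevLauterStein2009, §3.6 (arXiv:0707.0032)] -/
theorem twistSelmer_5_neg111_19_noTwist
    (h54 : sign_conjAct_kolyvaginClass) (h43 : lemma43_kolyvaginClass_mem_selmerLocalKer)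
    (h44 : prop44_localOrder_kolyvaginClass_mul_eq) (h53 : lemma53_selmer_eigen_dependent_at)
    (h22 : prop22_reciprocity_eigen_finset)
    (K : Type) [Field K] [NumberField K] (hK : IsImaginaryQuadratic K)
    (hD : NumberField.discr K = -111) :
    haveI := isElliptic_c916c1;
    haveI := isGloballyMinimal_c916c1;
    haveI : NeZero (((⟨0, 0, 0, -4, 1⟩ : WeierstrassCurve ℤ).map (Int.castRingHom ℚ)).conductorNorm ℤ) :=
      neZero_conductorNorm_of_isElliptic _;
    ∀ (Dt : ModularParametrizationData ((⟨0, 0, 0, -4, 1⟩ : WeierstrassCurve ℤ).map (Int.castRingHom ℚ))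
        (((⟨0, 0, 0, -4, 1⟩ : WeierstrassCurve ℤ).map (Int.castRingHom ℚ)).conductorNorm ℤ)) (β : ℤ)
      (ι : K →+* ℂ) (d : ∀ m : ℕ, KolyvaginHeegnerData Dt β ι m),
    (∀ (m l : ℕ), ∀ l' ∈ m.primeFactors, ∀ (x : ringClassField K ι m)
      (x' : ringClassField K ι (m * l)),
      (x : ℂ) = x' → (((d (m * l)).σ l' x' : ringClassField K ι (m * l)) : ℂ) = ((d m).σ l' x : ℂ)) →
    (∀ (m l : ℕ), ∀ s ∈ (d m).S, ∃ s' ∈ (d (m * l)).S, ∀ (x : ringClassField K ι m)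
      (x' : ringClassField K ι (m * l)),
      (x : ℂ) = x' → ((s' x' : ringClassField K ι (m * l)) : ℂ) = (s x : ℂ)) →
    (∀ (m l : ℕ), ∀ s' ∈ (d (m * l)).S, ∃ s ∈ (d m).S, ∀ (x : ringClassField K ι m)
      (x' : ringClassField K ι (m * l)),
      (x : ℂ) = x' → ((s' x' : ringClassField K ι (m * l)) : ℂ) = (s x : ℂ)) →
    (∀ (m l : ℕ) (x : ringClassField K ι m) (x' : ringClassField K ι (m * l)),
      (x : ℂ) = x' → (d (m * l)).emb x' = (d m).emb x) →
    (d 19).kolyvaginClass (p := 5) (by norm_num) 1 ≠ 0 →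
    Nat.card ↥(selmerGroup (((⟨0, 0, 0, -4, 1⟩ : WeierstrassCurve ℤ).map (Int.castRingHom ℚ)).quadraticTwist
        ((-111 : ℤ) : ℚ)) ((5 : ℕ) : ℤ)) ≤ 5 ∧
      5 ^ (((⟨0, 0, 0, -4, 1⟩ : WeierstrassCurve ℤ).map (Int.castRingHom ℚ)).quadraticTwist
        ((-111 : ℤ) : ℚ)).mordellWeilRank *
          Nat.card ↥(AddSubgroup.torsionBy (((⟨0, 0, 0, -4, 1⟩ : WeierstrassCurve ℤ).map (Int.castRingHom ℚ)).quadraticTwist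
        ((-111 : ℤ) : ℚ)).toAffine.Point ((5 : ℕ) : ℤ)) *
          Nat.card ↥((((⟨0, 0, 0, -4, 1⟩ : WeierstrassCurve ℤ).map (Int.castRingHom ℚ)).quadraticTwist
        ((-111 : ℤ) : ℚ)).sha ⊓
            AddSubgroup.torsionBy (((⟨0, 0, 0, -4, 1⟩ : WeierstrassCurve ℤ).map (Int.castRingHom ℚ)).quadraticTwist
        ((-111 : ℤ) : ℚ)).galH1 ((5 : ℕ) : ℤ)) ≤ 5 := by
  haveI := isElliptic_c916c1
  haveI := isGloballyMinimal_c916c1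
  haveI : NeZero (((⟨0, 0, 0, -4, 1⟩ : WeierstrassCurve ℤ).map (Int.castRingHom ℚ)).conductorNorm ℤ) :=
    neZero_conductorNorm_of_isElliptic _
  intro Dt β ι d hσ hS₁ hS₂ hemb hne
  haveI := Fact.mk (by norm_num : Nat.Prime 5)
  exact depthRow_noTwist_twistSelmer_of_print_of_intModel_certificate intModel h54 h43 h44 h53 h22 not_hasCM
    KernelCerts002.C916c1.two_le_rank 5 (by norm_num) hasSurjectiveModNGaloisRep_pow_5 K hK hD
    (by norm_num) (by norm_num) heegner_neg111 19 (by norm_num) (by norm_num) (by decide +kernel)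
    (by norm_num) (by norm_num) (by norm_num) (by norm_num) (n := 25) card_19 (by norm_num) Dt β ι
    d hσ hS₁ hS₂ hemb hne

end C916c1

namespace C944e1

/-- **DEPTH-TABLE ROW `944e1`, `(p, d_K, ℓ) = (5, -31, 239)` — THE TWIST'S `5`-SELMER GROUP, without
Kolyvagin's structure theorem and without a point on the twist.** Hypotheses VERBATIM those of
`C944e1.depthRow_5_neg31_239_noTwist` (five named McCallum/Gross leaves, any imaginary quadratic `K` with `d_K = -31`,
any frame and COMPATIBLE system of Kolyvagin–Heegner data, the bit `(d 239).kolyvaginClass _ 1 ≠ 0`);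
conclusion: `#Sel^(5)(E^{(-31)}/ℚ) ≤ 5` (i.e. `dim_𝔽5 Sel_5(E^{(-31)}/ℚ) ≤ 1`) and the descent count
`5^{rank E^{(-31)}(ℚ)} · #E^{(-31)}(ℚ)[5] · #Ш(E^{(-31)}/ℚ)[5] ≤ 5` — Kolyvagin's second eigen-bound
`#Sel(E/K)_5^- ≤ 5` read over `ℚ` (kit `depthRow_noTwist_twistSelmer_of_print_of_intModel_certificate`); the
hF-free, twist-point-free counterpart of the hF-row's `corank Sel_{5^∞}(E^{(-31)}/ℚ) = 1`. CONDITIONAL on the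
five facts and the bit; per-curve; BSD is not proved by it. [cite: Kolyvagin1991MathAnn, Thm. 2.3]
[cite: McCallumLMS1991, §§2–5] [cite: GrossLMS1991, §5 (5.1)]
[cite: JetchevLauterStein2009, §3.6 (arXiv:0707.0032)] -/
theorem twistSelmer_5_neg31_239_noTwist
    (h54 : sign_conjAct_kolyvaginClass) (h43 : lemma43_kolyvaginClass_mem_selmerLocalKer)
    (h44 : prop44_localOrder_kolyvaginClass_mul_eq) (h53 : lemma53_selmer_eigen_dependent_at)
    (h22 : prop22_reciprocity_eigen_finset)
    (K : Type) [Field K] [NumberField K] (hK : IsImaginaryQuadratic K)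
    (hD : NumberField.discr K = -31) :
    haveI := isElliptic_c944e1;
    haveI := isGloballyMinimal_c944e1;
    haveI : NeZero (((⟨0, 0, 0, -19, 34⟩ : WeierstrassCurve ℤ).map (Int.castRingHom ℚ)).conductorNorm ℤ) :=
      neZero_conductorNorm_of_isElliptic _;
    ∀ (Dt : ModularParametrizationData ((⟨0, 0, 0, -19, 34⟩ : WeierstrassCurve ℤ).map (Int.castRingHom ℚ))
        (((⟨0, 0, 0, -19, 34⟩ : WeierstrassCurve ℤ).map (Int.castRingHom ℚ)).conductorNorm ℤ)) (β : ℤ)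
      (ι : K →+* ℂ) (d : ∀ m : ℕ, KolyvaginHeegnerData Dt β ι m),
    (∀ (m l : ℕ), ∀ l' ∈ m.primeFactors, ∀ (x : ringClassField K ι m)
      (x' : ringClassField K ι (m * l)),
      (x : ℂ) = x' → (((d (m * l)).σ l' x' : ringClassField K ι (m * l)) : ℂ) = ((d m).σ l' x : ℂ)) →
    (∀ (m l : ℕ), ∀ s ∈ (d m).S, ∃ s' ∈ (d (m * l)).S, ∀ (x : ringClassField K ι m)
      (x' : ringClassField K ι (m * l)),
      (x : ℂ) = x' → ((s' x' : ringClassField K ι (m * l)) : ℂ) = (s x : ℂ)) →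
    (∀ (m l : ℕ), ∀ s' ∈ (d (m * l)).S, ∃ s ∈ (d m).S, ∀ (x : ringClassField K ι m)
      (x' : ringClassField K ι (m * l)),
      (x : ℂ) = x' → ((s' x' : ringClassField K ι (m * l)) : ℂ) = (s x : ℂ)) →
    (∀ (m l : ℕ) (x : ringClassField K ι m) (x' : ringClassField K ι (m * l)),
      (x : ℂ) = x' → (d (m * l)).emb x' = (d m).emb x) →
    (d 239).kolyvaginClass (p := 5) (by norm_num) 1 ≠ 0 →
    Nat.card ↥(selmerGroup (((⟨0, 0, 0, -19, 34⟩ : WeierstrassCurve ℤ).map (Int.castRingHom ℚ)).quadraticTwist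
        ((-31 : ℤ) : ℚ)) ((5 : ℕ) : ℤ)) ≤ 5 ∧
      5 ^ (((⟨0, 0, 0, -19, 34⟩ : WeierstrassCurve ℤ).map (Int.castRingHom ℚ)).quadraticTwist
        ((-31 : ℤ) : ℚ)).mordellWeilRank *
          Nat.card ↥(AddSubgroup.torsionBy (((⟨0, 0, 0, -19, 34⟩ : WeierstrassCurve ℤ).map (Int.castRingHom ℚ)).quadraticTwist
        ((-31 : ℤ) : ℚ)).toAffine.Point ((5 : ℕ) : ℤ)) *
          Nat.card ↥((((⟨0, 0, 0, -19, 34⟩ : WeierstrassCurve ℤ).map (Int.castRingHom ℚ)).quadraticTwist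
        ((-31 : ℤ) : ℚ)).sha ⊓
            AddSubgroup.torsionBy (((⟨0, 0, 0, -19, 34⟩ : WeierstrassCurve ℤ).map (Int.castRingHom ℚ)).quadraticTwist
        ((-31 : ℤ) : ℚ)).galH1 ((5 : ℕ) : ℤ)) ≤ 5 := by
  haveI := isElliptic_c944e1
  haveI := isGloballyMinimal_c944e1
  haveI : NeZero (((⟨0, 0, 0, -19, 34⟩ : WeierstrassCurve ℤ).map (Int.castRingHom ℚ)).conductorNorm ℤ) :=
    neZero_conductorNorm_of_isElliptic _
  intro Dt β ι d hσ hS₁ hS₂ hemb hne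
  haveI := Fact.mk (by norm_num : Nat.Prime 5)
  exact depthRow_noTwist_twistSelmer_of_print_of_intModel_certificate intModel h54 h43 h44 h53 h22 not_hasCM
    KernelCerts002.C944e1.two_le_rank 5 (by norm_num) hasSurjectiveModNGaloisRep_pow_5 K hK hD
    (by norm_num) (by norm_num) heegner_neg31 239 (by norm_num) (by norm_num) (by decide +kernel)
    (by norm_num) (by norm_num) (by norm_num) (by norm_num) (n := 255) card_239 (by norm_num) Dt β ι
    d hσ hS₁ hS₂ hemb hne

end C944e1

end Summit.BirchSwinnertonDyer.BirchSwinnertonDyer.Theorems.KolyvaginDepthDoor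

end
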